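import Literature.NumberTheory.Automorphic.UnitaryGroupSingularCentralizerDock   -- ★ §1 :65 `exists_continuousMulEquiv_coe_eq_of_injective` (open mapping WITH the formula)
import Literature.NumberTheory.Automorphic.UnitaryGroupBlockDiagPointsLevels      -- ★ p852326 `adelicBlockDiag_mem_range_toAdelic_iff` (rational points blockwise)
import HarnessLib

/-!
# The adelic centraliser of a rational block scalar `δ = a·1 ⊕ᶠ b·1` IS `U(J₁)(𝔸) × U(J₂)(𝔸)` — the isomorphism WITH ITS MAP
# (`(u₁, u₂) ↦ u₁ ⊕ᶠ u₂`) and its lattice clause; the block model of Rogawski's Prop. 3.8.1 (a) at the IDENTITY frame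
(Rogawski 1990 §3.8 Prop. 3.8.1 (a) p. 27 «`G_γ ≅ H′_ξ × E¹`»; §14.5 Lemma 14.5.2 (b) p. 238 «`m(I_γ(F)∖I_γ(𝔸)) = m(U(H_a)(F)∖U(H_a)(𝔸))·m(E¹∖𝔸¹_E)`»;
Platonov–Rapinchuk 1994 §5.1)

Topic `NumberTheory/Automorphic`; namespace `Literature.NumberTheory.Automorphic.UnitaryGroup`.  THEOREMS ONLY (no definition, no instance, no
notation, no named fact, no `sorry`).  Sequel of ★ `UnitaryGroupBlockDiagPointsLevels` (rational points ∕ levels blockwise) over ★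
`UnitaryGroupBlockCentralizer` :258 (`Z(δ ⊗ 1) = range adelicBlockDiag`), ★ `UnitaryGroupAdelicCentralizerProduct` :104 (the `Nonempty (≃ₜ*)`,
formula-free) and ★ `UnitaryGroupSingularCentralizerDock` (§1 :65 the open-mapping `≃ₜ*` WITH its underlying map; §2 :108 the dock for a general
hermitian `H ∈ M₃(L)` at a CHOSEN frame `P`, blocks `H_a, H_b` produced by ★ `exists_singular_frame_of_isSemisimpleElt`).

WHAT IS NEW.  In the BLOCK MODEL — Gram matrix literally `J₁ ⊕ᶠ J₂`, rational element literally `a·1 ⊕ᶠ b·1` — the frame is `P = 1` and the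
blocks are THE GIVEN `J₁, J₂`; the two ★ files above either forget the map (:104) or choose their own frame and blocks (:108).  A consumer comparing
TWO block models with prescribed blocks (the Z1♭ ⟸ Z1♭♭ junction of the LH5 line: covolume of `Z_{γ₀}` for `H_a ⊕ᶠ H_b` versus `H_a′ ⊕ᶠ H_b′`)
needs the isomorphism onto `U(J₁)(𝔸) × U(J₂)(𝔸)` ITSELF, with the lattice clause `hΛe` of ★ `LatticeCovolumeProd.covolume_count_eq_mul_of_mulEquiv_prod` :138.

* §1 (generic CM `E∕F`, `c`, sizes `M₁ M₂`, Gram `J₁ J₂`; `a ≠ b ∈ E`; `δ ∈ U(J₁ ⊕ᶠ J₂)(F)` with matrix `a·1 ⊕ᶠ b·1`)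
  **`exists_continuousMulEquiv_centralizer_toAdelic_coe_eq_adelicBlockDiag`** — `∃ e : U(J₁)(𝔸_F) × U(J₂)(𝔸_F) ≃ₜ* Z(δ ⊗ 1)` with
  (FORMULA) `↑(e u) = adelicBlockDiag u` and (LATTICE) `e u ∈ ((range toAdelic) ⊓ Z).subgroupOf Z ↔ u ∈ (range toAdelic) ×ˢ (range toAdelic)`.
* §2 (bridge) **`subgroupCongr_mem_cmDatum_arithmeticSubgroup_iff`** — along the identity-on-matrices identification
  `UnitaryGroup.adelic L⁺ L c N H = (cmDatum L N H).Adelic` (★ `adelic_complexConj`), the rational points correspond: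
  `x ∈ (cmDatum L N H).arithmeticSubgroup ↔ x ∈ range (UnitaryGroup.toAdelic L⁺ L c N H)`.
* §3 (CM currency, the tokens of the LH5 letter Z1♭: `L` CM, `Ha ∈ M₂(L)`, `Hb ∈ M₁(L)`, `γ₀ : (cmDatum L 3 (Ha ⊕ᶠ Hb)).Rational` with matrix
  `a·1₂ ⊕ᶠ b·1₁`, `a ≠ b`) **`exists_continuousMulEquiv_centralizer_cmDatum_toAdelic_of_eq_finSum`** —
  `∃ e : (cmDatum L 2 Ha).Adelic × (cmDatum L 1 Hb).Adelic ≃ₜ* Z((cmDatum L 3 (Ha ⊕ᶠ Hb)).toAdelic γ₀)` with (FORMULA)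
  `(e u).val = reindexGL finSumFinEquiv (blockDiagGL (u.1.val, u.2.val))`, (RATIONAL POINTS) `↑(e u) ∈ arithmeticSubgroup ↔ u.1 ∈ … ∧ u.2 ∈ …`,
  (LATTICE) `e u ∈ ((quotientSubgroup ⊓ Z).subgroupOf Z) ↔ u ∈ quotientSubgroup ×ˢ quotientSubgroup` — ★ Dock :108's three clauses VERBATIM at
  the identity frame (no `toAdeleGL L P` conjugation), for the GIVEN blocks; no hermitian ∕ non-degeneracy binder (carrier facts).
HONEST LABEL: count-neutral plumbing (no Haar splitting, no covolume identity, no organ of the LH5 line is paid; Z1♭'s print floor [Kottwitz1988 Thm 1]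
is untouched); HC_CM is proved only modulo the printed citations until rung 0 closes.

## References
* J. Rogawski, *Automorphic Representations of Unitary Groups in Three Variables*, Ann. of Math. Stud. 123 (1990), §3.8 Prop. 3.8.1 (a) p. 27;
  §14.5 Lemma 14.5.2 (b) pp. 238–239. [Rogawski1990]
* V. Platonov, A. Rapinchuk, *Algebraic Groups and Number Theory*, Academic Press (1994), §5.1. [PlatonovRapinchuk1994]
* S. Gelbart, *Automorphic Forms on Adele Groups*, Ann. of Math. Stud. 83 (1975), Remark 9.23. [Gelbart1975]
-/

set_option autoImplicit false

noncomputable section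

open scoped MatrixGroups Matrix
open NumberField Topology

namespace Literature.NumberTheory.Automorphic.UnitaryGroup

/-! ## §1 Generic: `U(J₁)(𝔸_F) × U(J₂)(𝔸_F) ≃ₜ* Z(δ ⊗ 1)` with its map and its lattice clause -/

section Adelic

variable (F E : Type) [Field F] [NumberField F] [Field E] [NumberField E] [Algebra F E]
  (c : E ≃ₐ[F] E) (M₁ M₂ : ℕ) (J₁ : Matrix (Fin M₁) (Fin M₁) E) (J₂ : Matrix (Fin M₂) (Fin M₂) E)

omit [NumberField F] in
/-- **The adelic centraliser of a rational block scalar IS `U(J₁)(𝔸) × U(J₂)(𝔸)`, with the map**: for `a ≠ b` in `E` and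
`δ ∈ U(J₁ ⊕ᶠ J₂)(F)` with matrix `a·1 ⊕ᶠ b·1`, there is an isomorphism of topological groups
`e : U(J₁)(𝔸_F) × U(J₂)(𝔸_F) ≃ₜ* Z_{U(J₁ ⊕ᶠ J₂)(𝔸_F)}(δ ⊗ 1)` whose underlying map is `(u₁, u₂) ↦ u₁ ⊕ᶠ u₂` (★ `adelicBlockDiag`: continuous,
injective, range `= Z(δ ⊗ 1)` by ★ `centralizer_toAdelic_eq_range_adelicBlockDiag`; open mapping theorem ★ `exists_continuousMulEquiv_coe_eq_of_injective`),
and which carries the product lattice `U(J₁)(F) × U(J₂)(F)` EXACTLY onto `Z ∩ U(J₁ ⊕ᶠ J₂)(F)` (★ `adelicBlockDiag_mem_range_toAdelic_iff`) — the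
`hΛe` clause of ★ `LatticeCovolumeProd.covolume_count_eq_mul_of_mulEquiv_prod`.
[cite: Rogawski1990, §3.8 Prop. 3.8.1 p. 27; §14.5 Lemma 14.5.2 (b) p. 238] [cite: PlatonovRapinchuk1994, §5.1] -/
theorem exists_continuousMulEquiv_centralizer_toAdelic_coe_eq_adelicBlockDiag {a b : E} (hab : a ≠ b)
    (δ : rational F E c (M₁ + M₂) (finSum M₁ M₂ J₁ J₂))
    (hδ : ((δ : GL (Fin (M₁ + M₂)) E) : Matrix (Fin (M₁ + M₂)) (Fin (M₁ + M₂)) E) =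
      finSum M₁ M₂ (a • (1 : Matrix (Fin M₁) (Fin M₁) E)) (b • 1)) :
    ∃ e : (adelic F E c M₁ J₁ × adelic F E c M₂ J₂) ≃ₜ*
        ↥(Subgroup.centralizer ({toAdelic F E c (M₁ + M₂) (finSum M₁ M₂ J₁ J₂) δ} : Set (adelic F E c (M₁ + M₂) (finSum M₁ M₂ J₁ J₂)))),
      (∀ u, ((e u : ↥(Subgroup.centralizer ({toAdelic F E c (M₁ + M₂) (finSum M₁ M₂ J₁ J₂) δ} :
            Set (adelic F E c (M₁ + M₂) (finSum M₁ M₂ J₁ J₂))))) : adelic F E c (M₁ + M₂) (finSum M₁ M₂ J₁ J₂)) =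
          adelicBlockDiag F E c M₁ M₂ J₁ J₂ u) ∧
      (∀ u, e u ∈ ((toAdelic F E c (M₁ + M₂) (finSum M₁ M₂ J₁ J₂)).range ⊓
            Subgroup.centralizer ({toAdelic F E c (M₁ + M₂) (finSum M₁ M₂ J₁ J₂) δ} :
              Set (adelic F E c (M₁ + M₂) (finSum M₁ M₂ J₁ J₂)))).subgroupOf
            (Subgroup.centralizer ({toAdelic F E c (M₁ + M₂) (finSum M₁ M₂ J₁ J₂) δ} :
              Set (adelic F E c (M₁ + M₂) (finSum M₁ M₂ J₁ J₂)))) ↔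
          u ∈ (toAdelic F E c M₁ J₁).range.prod (toAdelic F E c M₂ J₂).range) := by
  set C : Subgroup (adelic F E c (M₁ + M₂) (finSum M₁ M₂ J₁ J₂)) :=
    Subgroup.centralizer ({toAdelic F E c (M₁ + M₂) (finSum M₁ M₂ J₁ J₂) δ} : Set (adelic F E c (M₁ + M₂) (finSum M₁ M₂ J₁ J₂)))
    with hCdef
  have hC : (adelicBlockDiag F E c M₁ M₂ J₁ J₂).range = C :=
    (centralizer_toAdelic_eq_range_adelicBlockDiag F E c M₁ M₂ J₁ J₂ hab δ hδ).symm
  have hCc : IsClosed (C : Set (adelic F E c (M₁ + M₂) (finSum M₁ M₂ J₁ J₂))) := Set.isClosed_centralizer _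
  obtain ⟨e, he⟩ := exists_continuousMulEquiv_coe_eq_of_injective (adelicBlockDiag F E c M₁ M₂ J₁ J₂)
    (adelicBlockDiag_injective F E c M₁ M₂ J₁ J₂) (continuous_adelicBlockDiag F E c M₁ M₂ J₁ J₂) C hC hCc
  refine ⟨e, he, fun u => ?_⟩
  have hmem : adelicBlockDiag F E c M₁ M₂ J₁ J₂ u ∈ C := by rw [← he]; exact (e u).2
  rw [Subgroup.mem_subgroupOf, Subgroup.mem_inf, he, ← comap_adelicBlockDiag_range_toAdelic F E c M₁ M₂ J₁ J₂, Subgroup.mem_comap]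
  exact ⟨fun h => h.1, fun h => ⟨h, hmem⟩⟩

end Adelic

/-! ## §2 Bridge: rational points in the two currencies `UnitaryGroup.adelic L⁺ L c N H` and `(cmDatum L N H).Adelic` -/

section Bridge

variable (L : Type) [Field L] [NumberField L] [IsCMField L] (N : ℕ) (H : Matrix (Fin N) (Fin N) L)

/-- **Rational points correspond under the identity-on-matrices identification** `U(H)(𝔸)` (generic carrier, ★ `UnitaryGroup.adelic`) `=`
`(cmDatum L N H).Adelic` (★ `adelic_complexConj`): the image of `x` lies in the arithmetic subgroup `(cmDatum L N H).toAdelic.range` iff `x`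
lies in `range (UnitaryGroup.toAdelic L⁺ L c N H)` — both say «the matrix of `x` is the diagonal image of a rational unitary matrix»
(★ `rational_complexConj`, ★ `coe_cmDatum_toAdelic`). [cite: PlatonovRapinchuk1994, §5.1] -/
theorem subgroupCongr_mem_cmDatum_arithmeticSubgroup_iff
    (x : ↥(adelic (↥(maximalRealSubfield L)) L (IsCMField.complexConj L) N H)) :
    (MulEquiv.subgroupCongr (adelic_complexConj L N H) x : (cmDatum L N H).Adelic) ∈ (cmDatum L N H).arithmeticSubgroup ↔
      x ∈ (toAdelic (↥(maximalRealSubfield L)) L (IsCMField.complexConj L) N H).range := by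
  show _ ∈ (cmDatum L N H).toAdelic.range ↔ _
  rw [MonoidHom.mem_range, MonoidHom.mem_range]
  constructor
  · rintro ⟨g, hg⟩
    refine ⟨⟨(g.val : GL (Fin N) L), by rw [rational_complexConj]; exact g.2⟩, ?_⟩
    apply Subtype.ext
    exact congrArg (fun z : (cmDatum L N H).Adelic => (z.val : GL (Fin N) (AdeleRing (𝓞 L) L))) hg
  · rintro ⟨g, hg⟩
    refine ⟨⟨(g : GL (Fin N) L), by rw [← rational_complexConj]; exact g.2⟩, ?_⟩
    apply Subtype.ext
    exact congrArg (fun z : ↥(adelic (↥(maximalRealSubfield L)) L (IsCMField.complexConj L) N H) =>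
      ((z : ↥(adelic (↥(maximalRealSubfield L)) L (IsCMField.complexConj L) N H)) : GL (Fin N) (AdeleRing (𝓞 L) L))) hg

/-- The same with the identification run backwards (`ι := (subgroupCongr _).symm`, the direction used on the blocks):
`ι.symm`-free form `y ∈ arithmeticSubgroup ↔ (subgroupCongr _).symm y ∈ range toAdelic`. [cite: PlatonovRapinchuk1994, §5.1] -/
theorem mem_cmDatum_arithmeticSubgroup_iff_subgroupCongr_symm_mem (y : (cmDatum L N H).Adelic) :
    y ∈ (cmDatum L N H).arithmeticSubgroup ↔
      (MulEquiv.subgroupCongr (adelic_complexConj L N H)).symm y ∈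
        (toAdelic (↥(maximalRealSubfield L)) L (IsCMField.complexConj L) N H).range := by
  rw [← subgroupCongr_mem_cmDatum_arithmeticSubgroup_iff L N H, MulEquiv.apply_symm_apply]
  exact Iff.rfl

end Bridge

/-! ## §3 CM currency: the block model `H = Ha ⊕ᶠ Hb`, `γ₀ = a·1₂ ⊕ᶠ b·1₁`, at the identity frame -/

section CM

open Literature.AlgebraicGeometry.ShimuraVarieties (unitaryGroup)

variable (L : Type) [Field L] [NumberField L] [IsCMField L] (Ha : Matrix (Fin 2) (Fin 2) L) (Hb : Matrix (Fin 1) (Fin 1) L)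

/-- **THE BLOCK-MODEL DOCK (identity frame).**  For `L` CM, ANY `Ha ∈ M₂(L)`, `Hb ∈ M₁(L)`, `a ≠ b` in `L`, and a rational
`γ₀ ∈ U(Ha ⊕ᶠ Hb)(L⁺)` whose matrix IS `a·1₂ ⊕ᶠ b·1₁`: there is an isomorphism of topological groups
`e : U(Ha)(𝔸_{L⁺}) × U(Hb)(𝔸_{L⁺}) ≃ₜ* Z_{U(Ha ⊕ᶠ Hb)(𝔸_{L⁺})}(γ₀ ⊗ 1)` (in the `cmDatum` currency of the LH5 letter Z1♭) which
(FORMULA) is `(u_a, u_b) ↦ u_a ⊕ u_b` on matrices, (RATIONAL POINTS) carries `U(Ha)(L⁺) × U(Hb)(L⁺)` EXACTLY onto `Z ∩ U(Ha ⊕ᶠ Hb)(L⁺)`, and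
(LATTICE CLAUSE) satisfies the `hΛe` hypothesis of ★ `covolume_count_eq_mul_of_mulEquiv_prod` for `Λ := ((quotientSubgroup ⊓ Z).subgroupOf Z)` with
the GIVEN blocks `Ha, Hb` (`A_G = 1`: ★ `cmDatum_quotientSubgroup` = `cmDatum_arithmeticSubgroup`).  This is ★ Dock
`exists_frame_continuousMulEquiv_centralizer_toAdelic_of_singular` at the frame `P = 1`, assembled from §1 and the bridge §2.
[cite: Rogawski1990, §3.8 Prop. 3.8.1 p. 27; §14.5 Lemma 14.5.2 (b) p. 238] [cite: Gelbart1975, Remark 9.23] -/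
theorem exists_continuousMulEquiv_centralizer_cmDatum_toAdelic_of_eq_finSum {a b : L} (hab : a ≠ b)
    (γ₀ : (cmDatum L 3 (finSum 2 1 Ha Hb)).Rational)
    (hγ₀ : ((γ₀.val : GL (Fin 3) L) : Matrix (Fin 3) (Fin 3) L) = finSum 2 1 (a • (1 : Matrix (Fin 2) (Fin 2) L)) (b • 1)) :
    ∃ e : ((cmDatum L 2 Ha).Adelic × (cmDatum L 1 Hb).Adelic) ≃ₜ*
        ↥(Subgroup.centralizer ({(cmDatum L 3 (finSum 2 1 Ha Hb)).toAdelic γ₀} : Set (cmDatum L 3 (finSum 2 1 Ha Hb)).Adelic)),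
      (∀ u, (((e u : ↥(Subgroup.centralizer ({(cmDatum L 3 (finSum 2 1 Ha Hb)).toAdelic γ₀} :
            Set (cmDatum L 3 (finSum 2 1 Ha Hb)).Adelic))) : (cmDatum L 3 (finSum 2 1 Ha Hb)).Adelic).val :
              GL (Fin 3) (AdeleRing (𝓞 L) L)) =
          reindexGL finSumFinEquiv (blockDiagGL (u.1.val, u.2.val))) ∧
      (∀ u, ((e u : ↥(Subgroup.centralizer ({(cmDatum L 3 (finSum 2 1 Ha Hb)).toAdelic γ₀} :
            Set (cmDatum L 3 (finSum 2 1 Ha Hb)).Adelic))) : (cmDatum L 3 (finSum 2 1 Ha Hb)).Adelic) ∈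
            (cmDatum L 3 (finSum 2 1 Ha Hb)).arithmeticSubgroup ↔
          u.1 ∈ (cmDatum L 2 Ha).arithmeticSubgroup ∧ u.2 ∈ (cmDatum L 1 Hb).arithmeticSubgroup) ∧
      (∀ u, e u ∈ ((cmDatum L 3 (finSum 2 1 Ha Hb)).quotientSubgroup ⊓
            Subgroup.centralizer ({(cmDatum L 3 (finSum 2 1 Ha Hb)).toAdelic γ₀} : Set (cmDatum L 3 (finSum 2 1 Ha Hb)).Adelic)).subgroupOf
            (Subgroup.centralizer ({(cmDatum L 3 (finSum 2 1 Ha Hb)).toAdelic γ₀} : Set (cmDatum L 3 (finSum 2 1 Ha Hb)).Adelic)) ↔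
          u ∈ ((cmDatum L 2 Ha).quotientSubgroup).prod ((cmDatum L 1 Hb).quotientSubgroup)) := by
  -- notation: the centraliser `C`, the element `γ₀` in the generic currency
  set C : Subgroup (cmDatum L 3 (finSum 2 1 Ha Hb)).Adelic :=
    Subgroup.centralizer ({(cmDatum L 3 (finSum 2 1 Ha Hb)).toAdelic γ₀} : Set (cmDatum L 3 (finSum 2 1 Ha Hb)).Adelic) with hCdef
  let δ' : rational (↥(maximalRealSubfield L)) L (IsCMField.complexConj L) (2 + 1) (finSum 2 1 Ha Hb) :=
    ⟨(γ₀.val : GL (Fin 3) L), by rw [rational_complexConj]; exact γ₀.2⟩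
  have hδ' : ((δ' : GL (Fin (2 + 1)) L) : Matrix _ _ L) = finSum 2 1 (a • (1 : Matrix (Fin 2) (Fin 2) L)) (b • 1) := hγ₀
  -- the three identity-on-matrices identifications between the generic and the `cmDatum` carriers
  let ιa : (cmDatum L 2 Ha).Adelic ≃* ↥(adelic (↥(maximalRealSubfield L)) L (IsCMField.complexConj L) 2 Ha) :=
    (MulEquiv.subgroupCongr (adelic_complexConj L 2 Ha)).symm
  let ιb : (cmDatum L 1 Hb).Adelic ≃* ↥(adelic (↥(maximalRealSubfield L)) L (IsCMField.complexConj L) 1 Hb) :=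
    (MulEquiv.subgroupCongr (adelic_complexConj L 1 Hb)).symm
  let κ : ↥(adelic (↥(maximalRealSubfield L)) L (IsCMField.complexConj L) (2 + 1) (finSum 2 1 Ha Hb)) ≃* (cmDatum L 3 (finSum 2 1 Ha Hb)).Adelic :=
    MulEquiv.subgroupCongr (adelic_complexConj L (2 + 1) (finSum 2 1 Ha Hb))
  -- the explicit homomorphism `Φ (u_a, u_b) = u_a ⊕ u_b`
  let Φ : (cmDatum L 2 Ha).Adelic × (cmDatum L 1 Hb).Adelic →* (cmDatum L 3 (finSum 2 1 Ha Hb)).Adelic :=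
    κ.toMonoidHom.comp
      ((adelicBlockDiag (↥(maximalRealSubfield L)) L (IsCMField.complexConj L) 2 1 Ha Hb).comp (ιa.toMonoidHom.prodMap ιb.toMonoidHom))
  have hΦapply : ∀ u, Φ u = κ (adelicBlockDiag (↥(maximalRealSubfield L)) L (IsCMField.complexConj L) 2 1 Ha Hb (ιa u.1, ιb u.2)) :=
    fun u => rfl
  have hΦval : ∀ u, ((Φ u : (cmDatum L 3 (finSum 2 1 Ha Hb)).Adelic).val : GL (Fin 3) (AdeleRing (𝓞 L) L)) =
      reindexGL finSumFinEquiv (blockDiagGL (u.1.val, u.2.val)) := fun u => rfl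
  have hΦc : Continuous Φ := by
    have hκc : Continuous κ := by
      refine continuous_induced_rng.2 ?_
      exact continuous_subtype_val
    have hιac : Continuous ιa := by
      refine continuous_induced_rng.2 ?_
      exact continuous_subtype_val
    have hιbc : Continuous ιb := by
      refine continuous_induced_rng.2 ?_
      exact continuous_subtype_val
    exact hκc.comp ((continuous_adelicBlockDiag (↥(maximalRealSubfield L)) L (IsCMField.complexConj L) 2 1 Ha Hb).comp
      ((hιac.comp continuous_fst).prodMk (hιbc.comp continuous_snd)))
  have hΦinj : Function.Injective Φ := by
    intro u v huv
    rw [hΦapply, hΦapply] at huv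
    have h := adelicBlockDiag_injective (↥(maximalRealSubfield L)) L (IsCMField.complexConj L) 2 1 Ha Hb (κ.injective huv)
    simp only [Prod.mk.injEq] at h
    exact Prod.ext (ιa.injective h.1) (ιb.injective h.2)
  -- `κ` sends `toAdelic δ′` to `toAdelic γ₀`
  have hγeq : κ (toAdelic (↥(maximalRealSubfield L)) L (IsCMField.complexConj L) (2 + 1) (finSum 2 1 Ha Hb) δ') =
      (cmDatum L 3 (finSum 2 1 Ha Hb)).toAdelic γ₀ :=
    Subtype.ext rfl
  -- the range of `Φ` is the centraliser
  have hr := centralizer_toAdelic_eq_range_adelicBlockDiag (↥(maximalRealSubfield L)) L (IsCMField.complexConj L) 2 1 Ha Hb hab δ' hδ'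
  have hmemC : ∀ z : (cmDatum L 3 (finSum 2 1 Ha Hb)).Adelic, z ∈ C ↔
      κ.symm z ∈ (adelicBlockDiag (↥(maximalRealSubfield L)) L (IsCMField.complexConj L) 2 1 Ha Hb).range := by
    intro z
    rw [← hr, hCdef, Subgroup.mem_centralizer_singleton_iff, Subgroup.mem_centralizer_singleton_iff, ← hγeq,
      ← κ.symm.injective.eq_iff, map_mul, map_mul, MulEquiv.symm_apply_apply]
  have hrange : Φ.range = C := by
    ext z
    rw [MonoidHom.mem_range, hmemC]
    constructor
    · rintro ⟨u, rfl⟩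
      rw [hΦapply, MulEquiv.symm_apply_apply]
      exact ⟨_, rfl⟩
    · rintro ⟨v, hv⟩
      refine ⟨(ιa.symm v.1, ιb.symm v.2), ?_⟩
      rw [hΦapply]
      show κ (adelicBlockDiag _ L _ 2 1 Ha Hb (ιa (ιa.symm v.1), ιb (ιb.symm v.2))) = z
      rw [MulEquiv.apply_symm_apply, MulEquiv.apply_symm_apply, Prod.mk.eta, hv, MulEquiv.apply_symm_apply]
  -- the isomorphism, by the open mapping theorem
  have hCc : IsClosed (C : Set (cmDatum L 3 (finSum 2 1 Ha Hb)).Adelic) := Set.isClosed_centralizer _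
  obtain ⟨e, he⟩ := exists_continuousMulEquiv_coe_eq_of_injective Φ hΦinj hΦc C hrange hCc
  -- the formula
  have hformula : ∀ u, (((e u : C) : (cmDatum L 3 (finSum 2 1 Ha Hb)).Adelic).val : GL (Fin 3) (AdeleRing (𝓞 L) L)) =
      reindexGL finSumFinEquiv (blockDiagGL (u.1.val, u.2.val)) := fun u => by
    rw [he]; exact hΦval u
  -- rational points: through the bridge §2 and ★ `adelicBlockDiag_mem_range_toAdelic_iff`
  have hrat : ∀ u, ((e u : C) : (cmDatum L 3 (finSum 2 1 Ha Hb)).Adelic) ∈ (cmDatum L 3 (finSum 2 1 Ha Hb)).arithmeticSubgroup ↔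
      u.1 ∈ (cmDatum L 2 Ha).arithmeticSubgroup ∧ u.2 ∈ (cmDatum L 1 Hb).arithmeticSubgroup := by
    intro u
    rw [he, hΦapply]
    refine (subgroupCongr_mem_cmDatum_arithmeticSubgroup_iff L (2 + 1) (finSum 2 1 Ha Hb) _).trans ?_
    rw [adelicBlockDiag_mem_range_toAdelic_iff]
    exact Iff.and (mem_cmDatum_arithmeticSubgroup_iff_subgroupCongr_symm_mem L 2 Ha u.1).symm
      (mem_cmDatum_arithmeticSubgroup_iff_subgroupCongr_symm_mem L 1 Hb u.2).symm
  refine ⟨e, hformula, hrat, fun u => ?_⟩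
  -- the lattice clause
  rw [Subgroup.mem_subgroupOf, Subgroup.mem_inf, Subgroup.mem_prod, cmDatum_quotientSubgroup, cmDatum_quotientSubgroup, cmDatum_quotientSubgroup,
    ← cmDatum_arithmeticSubgroup, ← cmDatum_arithmeticSubgroup, ← cmDatum_arithmeticSubgroup]
  exact ⟨fun h => (hrat u).1 h.1, fun h => ⟨(hrat u).2 h, (e u).2⟩⟩

end CM

end Literature.NumberTheory.Automorphic.UnitaryGroup

end
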